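import Literature.Computability.QuantumComplexity.WordCircuit
import Literature.Computability.QuantumComplexity.HadamardTest
import HarnessLib

/-!
# The Hadamard test in a big register: statistics of `H_q · D_s · condOn {q} U · H_q`

Topic `Literature/Computability/QuantumComplexity`; a step in the discharge of
`ajl_jonesApproxProblem_mem_PromiseBQP` (AJL §2.2: the Hadamard test outputs a `±1` variable with
mean `Re⟨α|Q|α⟩`, and with an extra phase `−i` on the control the mean `Im⟨α|Q|α⟩`). In a register of
any size, with the controlled unitary given as the conditioned matrix `condOn {q} U` of `CondGate.lean`
(`U` not touching the control wire `q`) and the control phase `D_s = diag(1, s)` on `q` (`s = 1` or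
`s = −i`): started on a basis state with `q = 0`, the control reads `0` with probability
`(1 + Re(s · U_{x₁x₁}))/2`, `x₁` the input label with `q` set (`hadTestOp_prob`). The operator is
realised by the Clifford+T gates `H_q`, `S_q³ = diag(1, −i)` around any circuit implementing
`condOn {q} U` (`hadTestCircuit`, `hadTestCircuit_toMatrix_of`).

## References

* D. Aharonov, V. Jones, Z. Landau, Algorithmica 55 (2009), §2.2 (the Hadamard test, real and
  imaginary parts) [AharonovJonesLandau2009].
-/

noncomputable section

namespace Literature.Computability.QuantumComplexity

open _root_.Matrix Finset Cryptography
open scoped Matrix.Norms.L2Operator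

variable {N : ℕ}

/-! ### The operator -/

/-- The control phase `diag(1, s)` on wire `q`. [cite: AharonovJonesLandau2009, §2.2] -/
def ctrlPhase (q : Fin N) (s : ℂ) : Matrix (QReg N) (QReg N) ℂ := Matrix.diagonal fun x => if x q = true then s else 1

/-- **The Hadamard-test operator** `H_q · D_s · condOn {q} U · H_q`. [cite: AharonovJonesLandau2009, §2.2] -/
def hadTestOp (q : Fin N) (U : Matrix (QReg N) (QReg N) ℂ) (s : ℂ) : Matrix (QReg N) (QReg N) ℂ :=
  (hOn q).toMatrix 0 * (ctrlPhase q s * condOn {z | z q = true} U) * (hOn q).toMatrix 0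

/-- The squared modulus of a Hadamard-test amplitude (complex phase form). [folklore] -/
theorem norm_sq_half_ite_add (δ : Prop) [Decidable δ] (v : ℂ) :
    ‖((if δ then (1 : ℂ) else 0) + v) / 2‖ ^ 2 = (if δ then (1 + 2 * v.re) / 4 else 0) + ‖v‖ ^ 2 / 4 := by
  rw [Complex.sq_norm, Complex.sq_norm, Complex.normSq_apply, Complex.normSq_apply]
  split_ifs <;> simp <;> ring

section Stats

variable (q : Fin N) {U : Matrix (QReg N) (QReg N) ℂ} (hU : U ∈ Matrix.unitaryGroup (QReg N) ℂ)
  (hUq : ∀ x z : QReg N, x q ≠ z q → U x z = 0)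
include hUq

/-- The conditioned gate is the identity on labels with `q = 0`. [folklore] -/
theorem condOn_q_mulVec_basisState_false {x : QReg N} (hx : x q = false) : condOn {z : QReg N | z q = true} U *ᵥ basisState x = basisState x := by
  classical
  ext y
  rw [mulVec_basisState]; dsimp only
  rw [condOn_apply]
  split_ifs with hy
  · rw [Set.mem_setOf_eq] at hy
    rw [hUq y x (by rw [hy, hx]; decide), basisState]
    rw [Pi.single_apply, if_neg]; rintro rfl; rw [hx] at hy; exact Bool.false_ne_true hy
  · rw [basisState, Matrix.one_apply, Pi.single_apply]

/-- The conditioned gate is `U` on labels with `q = 1`. [folklore] -/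
theorem condOn_q_mulVec_basisState_true {x : QReg N} (hx : x q = true) : condOn {z : QReg N | z q = true} U *ᵥ basisState x = U *ᵥ basisState x := by
  classical
  ext y
  rw [mulVec_basisState, mulVec_basisState]; dsimp only
  rw [condOn_apply]
  split_ifs with hy
  · rfl
  · rw [Set.mem_setOf_eq] at hy
    rw [hUq y x (by rw [hx]; exact hy), Matrix.one_apply, if_neg]; rintro rfl; exact hy hx

include hU in
/-- **The statistics of the Hadamard test**: started on `|x₀⟩` with `x₀ q = 0`, the control reads `0`
with probability `(1 + Re(s·U_{x₁x₁}))/2` (`x₁ = x₀[q ↦ 1]`), for a unit phase `s`.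
[cite: AharonovJonesLandau2009, §2.2] -/
theorem hadTestOp_prob {x₀ : QReg N} (hx : x₀ q = false) {s : ℂ} (hs : ‖s‖ = 1) :
    ∑ y ∈ Finset.univ.filter (fun y : QReg N => y q = false), ‖(hadTestOp q U s *ᵥ basisState x₀) y‖ ^ 2 =
      (1 + (s * U (Function.update x₀ q true) (Function.update x₀ q true)).re) / 2 := by
  classical
  set x₁ := Function.update x₀ q true with hx₁
  have hx₀ : Function.update x₀ q false = x₀ := by rw [← hx, Function.update_eq_self]
  -- push the basis state through
  have h1 : (hOn q).toMatrix 0 *ᵥ basisState x₀ = invSqrt2 • (basisState x₀ + basisState x₁) := hOn_mulVec_basisState q x₀ hx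
  have h2 : condOn {z : QReg N | z q = true} U *ᵥ (invSqrt2 • (basisState x₀ + basisState x₁)) =
      invSqrt2 • (basisState x₀ + U *ᵥ basisState x₁) := by
    rw [Matrix.mulVec_smul, Matrix.mulVec_add, condOn_q_mulVec_basisState_false q hUq hx,
      condOn_q_mulVec_basisState_true q hUq (by rw [hx₁]; simp)]
  -- `U |x₁⟩` lives on `q = 1`
  have hUx₁ : U *ᵥ basisState x₁ = fun y => if y q = true then U y x₁ else 0 := by
    ext y; rw [mulVec_basisState]; split_ifs with hy
    · rfl
    · exact hUq y x₁ (by rw [hx₁]; simpa using hy)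
  have h3 : ctrlPhase q s *ᵥ (invSqrt2 • (basisState x₀ + U *ᵥ basisState x₁)) =
      invSqrt2 • (basisState x₀ + s • (U *ᵥ basisState x₁)) := by
    rw [Matrix.mulVec_smul, Matrix.mulVec_add]
    congr 2
    · ext y; rw [ctrlPhase, Matrix.mulVec_diagonal, basisState, Pi.single_apply]
      by_cases hy : y = x₀
      · subst hy; simp [hx]
      · simp [hy]
    · ext y; rw [ctrlPhase, Matrix.mulVec_diagonal, hUx₁, Pi.smul_apply, smul_eq_mul]
      by_cases hy : y q = true <;> simp [hy]
  have h4 : ∀ y : QReg N, y q = false → ((hOn q).toMatrix 0 *ᵥ (invSqrt2 • (basisState x₀ + s • (U *ᵥ basisState x₁)))) y =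
      ((if y = x₀ then (1 : ℂ) else 0) + s * U (Function.update y q true) x₁) / 2 := by
    intro y hy
    -- entries of `H_q v` at a label with `q = 0`: `(v y + v (y[q↦1]))/√2`
    have hH : ∀ v : QReg N → ℂ, ((hOn q).toMatrix 0 *ᵥ v) y = invSqrt2 * (v y + v (Function.update y q true)) := by
      intro v
      rw [hOn_toMatrix, Matrix.mulVec, dotProduct]
      have hsupp : ∀ z, z ≠ Function.update y q false → z ≠ Function.update y q true → placeGate (wireEmb q) hGate y z * v z = 0 := by
        intro z h0 h1
        rw [placeGate_apply, if_neg, zero_mul]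
        intro hh
        have hz : z = Function.update y q (z q) := by
          funext i
          by_cases hi : i = q
          · subst hi; simp
          · rw [Function.update_of_ne hi]; exact (hh i (by simp [hi])).symm
        cases hzq : z q
        · exact h0 (by rw [hz, hzq])
        · exact h1 (by rw [hz, hzq])
      rw [Fintype.sum_eq_add (Function.update y q false) (Function.update y q true)
        (fun h => by have := congrFun h q; simp at this) (fun z hz => hsupp z hz.1 hz.2)]
      have hy0 : Function.update y q false = y := by rw [← hy, Function.update_eq_self]
      rw [hy0, placeGate_apply, if_pos (fun i _ => rfl), placeGate_apply, if_pos (fun i hi => by rw [Function.update_of_ne]; rintro rfl; simp at hi)]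
      have e1 : (y ∘ wireEmb q) = fun _ => false := funext fun _ => hy
      have e2 : (Function.update y q true ∘ wireEmb q) = fun _ => true := funext fun _ => by simp
      rw [e1, e2, hGate_apply_const, hGate_apply_const, if_neg (by simp), if_neg (by simp), invSqrt2]
      ring
    rw [hH]
    simp only [Pi.smul_apply, Pi.add_apply, smul_eq_mul, hUx₁]
    have hyq1 : Function.update y q true q = true := by simp
    rw [if_neg (by rw [hy]; exact Bool.false_ne_true), if_pos hyq1]
    have hb0 : basisState x₀ y = if y = x₀ then (1 : ℂ) else 0 := by rw [basisState, Pi.single_apply]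
    have hb1 : basisState x₀ (Function.update y q true) = 0 := by
      rw [basisState, Pi.single_apply, if_neg]; intro h; have := congrFun h q; simp [hx] at this
    rw [hb0, hb1, invSqrt2]
    have : (Real.sqrt 2 : ℂ) ≠ 0 := by exact_mod_cast (Real.sqrt_pos.2 (by norm_num : (0:ℝ) < 2)).ne'
    field_simp
    rw [show ((Real.sqrt 2 : ℂ)) ^ 2 = 2 by rw [← Complex.ofReal_pow]; norm_num]
    ring
  -- the probability
  rw [hadTestOp, Matrix.mul_assoc, ← Matrix.mulVec_mulVec, ← Matrix.mulVec_mulVec, h1, ← Matrix.mulVec_mulVec, h2, h3]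
  rw [Finset.sum_filter]
  have hterm : ∀ y : QReg N, (if y q = false then ‖((hOn q).toMatrix 0 *ᵥ (invSqrt2 • (basisState x₀ + s • (U *ᵥ basisState x₁)))) y‖ ^ 2 else 0) =
      (if y q = false then ((if y = x₀ then (1 + 2 * (s * U (Function.update y q true) x₁).re) / 4 else 0) +
        ‖U (Function.update y q true) x₁‖ ^ 2 / 4) else 0) := by
    intro y
    by_cases hy : y q = false
    · rw [if_pos hy, if_pos hy, h4 y hy, norm_sq_half_ite_add, norm_mul, hs, one_mul]
    · rw [if_neg hy, if_neg hy]
  simp_rw [hterm]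
  -- re-index `y ↦ y[q ↦ 1]` onto the labels with `q = 1`
  have hsum : ∑ y : QReg N, (if y q = false then ((if y = x₀ then (1 + 2 * (s * U (Function.update y q true) x₁).re) / 4 else 0) +
      ‖U (Function.update y q true) x₁‖ ^ 2 / 4) else 0) =
      (1 + 2 * (s * U x₁ x₁).re) / 4 + (∑ y : QReg N, ‖U y x₁‖ ^ 2) / 4 := by
    rw [Finset.sum_ite, Finset.sum_const_zero, add_zero, Finset.sum_add_distrib]
    congr 1
    · rw [Finset.sum_ite, Finset.sum_const_zero, add_zero]
      have : (Finset.univ.filter fun y : QReg N => y q = false).filter (fun y => y = x₀) = {x₀} := by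
        ext y; simp only [Finset.mem_filter, Finset.mem_univ, true_and, Finset.mem_singleton]
        exact ⟨fun h => h.2, fun h => ⟨by rw [h, hx], h⟩⟩
      rw [this, Finset.sum_singleton, show Function.update x₀ q true = x₁ from rfl]
    · rw [← Finset.sum_div]
      congr 1
      -- `Σ_{y q = 0} |U (y[q↦1]) x₁|² = Σ_{y'} |U y' x₁|²` (terms with `y' q = 0` vanish)
      rw [← Finset.sum_filter_add_sum_filter_not Finset.univ (fun y : QReg N => y q = true) (fun y => ‖U y x₁‖ ^ 2)]
      have hz : ∑ y ∈ Finset.univ.filter (fun y : QReg N => ¬ y q = true), ‖U y x₁‖ ^ 2 = 0 :=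
        Finset.sum_eq_zero fun y hy => by
          rw [Finset.mem_filter] at hy
          rw [hUq y x₁ (by rw [hx₁]; simpa using hy.2), norm_zero]; ring
      rw [hz, add_zero]
      refine Finset.sum_nbij (fun y => Function.update y q true) (fun y hy => by simp) ?_ ?_ (fun y _ => rfl)
      · intro y hy y' hy' h
        simp only [Finset.coe_filter, Finset.mem_univ, true_and, Set.mem_setOf_eq] at hy hy'
        have h' : Function.update y q true = Function.update y' q true := h
        funext i
        by_cases hi : i = q
        · subst hi; rw [hy, hy']
        · have := congrFun h' i; rwa [Function.update_of_ne hi, Function.update_of_ne hi] at this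
      · intro y' hy'
        simp only [Finset.coe_filter, Finset.mem_univ, true_and, Set.mem_setOf_eq] at hy'
        refine ⟨Function.update y' q false, by simp, ?_⟩
        show Function.update (Function.update y' q false) q true = y'
        rw [Function.update_idem, ← hy', Function.update_eq_self]
  rw [hsum, sum_norm_sq_col_of_unitary hU x₁]
  ring

end Stats

/-! ### The circuit -/

/-- The control-phase gates: `S³ = diag(1, −i)` for the imaginary part, nothing for the real part.
[cite: AharonovJonesLandau2009, §2.2] -/
def ctrlPhaseGates (q : Fin N) (im : Bool) : List (QGate cliffordT N) := if im then [sOn q, sOn q, sOn q] else []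

/-- The phase used: `−i` or `1`. [cite: AharonovJonesLandau2009, §2.2] -/
def phaseOf (im : Bool) : ℂ := if im then -Complex.I else 1

/-- `|phaseOf im| = 1`. [folklore] -/
theorem norm_phaseOf (im : Bool) : ‖phaseOf im‖ = 1 := by unfold phaseOf; cases im <;> simp

/-- The control-phase gates realise `ctrlPhase q (phaseOf im)`. [folklore] -/
theorem toMatrix_ctrlPhaseGates (q : Fin N) (im : Bool) :
    (⟨ctrlPhaseGates q im⟩ : QCircuit cliffordT N).toMatrix 0 = ctrlPhase q (phaseOf im) := by
  refine matrix_ext_of_mulVec_basisState fun w => ?_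
  have hD : ctrlPhase q (phaseOf im) *ᵥ basisState w = (if w q = true then phaseOf im else 1) • basisState w := by
    ext y; rw [ctrlPhase, Matrix.mulVec_diagonal, Pi.smul_apply, basisState, Pi.single_apply, smul_eq_mul]
    by_cases hy : y = w
    · subst hy; simp
    · simp [hy]
  rw [hD]
  unfold ctrlPhaseGates phaseOf
  cases im
  · simp
  · simp only [if_true, QCircuit.toMatrix_cons, QCircuit.toMatrix_nil, Matrix.one_mul]
    rw [← Matrix.mulVec_mulVec, ← Matrix.mulVec_mulVec, sOn_mulVec_basisState, Matrix.mulVec_smul, sOn_mulVec_basisState,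
      Matrix.mulVec_smul, Matrix.mulVec_smul, sOn_mulVec_basisState, smul_smul, smul_smul]
    congr 1
    cases w q
    · simp
    · simp only [if_true]
      rw [show Complex.I * Complex.I = -1 from Complex.I_mul_I]; ring

/-- **The Hadamard-test circuit** around a circuit `C` (meant to implement `condOn {q} U`):
`H_q ; C ; [S_q³] ; H_q`. [cite: AharonovJonesLandau2009, §2.2] -/
def hadTestCircuit (q : Fin N) (C : QCircuit cliffordT N) (im : Bool) : QCircuit cliffordT N :=
  (((⟨[hOn q]⟩ : QCircuit cliffordT N).append C).append ⟨ctrlPhaseGates q im⟩).append ⟨[hOn q]⟩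

/-- Its matrix. [folklore] -/
theorem hadTestCircuit_toMatrix (q : Fin N) (C : QCircuit cliffordT N) (im : Bool) :
    (hadTestCircuit q C im).toMatrix 0 = (hOn q).toMatrix 0 * (ctrlPhase q (phaseOf im) * C.toMatrix 0) * (hOn q).toMatrix 0 := by
  rw [hadTestCircuit, QCircuit.toMatrix_append, QCircuit.toMatrix_append, QCircuit.toMatrix_append, toMatrix_ctrlPhaseGates,
    QCircuit.toMatrix_cons, QCircuit.toMatrix_nil, Matrix.one_mul]
  simp only [Matrix.mul_assoc]

/-- The Hadamard-test circuit is oracle-free when `C` is. [folklore] -/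
theorem hadTestCircuit_isOracleFree (q : Fin N) {C : QCircuit cliffordT N} (hC : C.IsOracleFree) (im : Bool) :
    (hadTestCircuit q C im).IsOracleFree := by
  intro g hg
  simp only [hadTestCircuit, QCircuit.append, List.mem_append, List.mem_singleton, ctrlPhaseGates] at hg
  rcases hg with ((rfl | hg) | hg) | rfl
  · trivial
  · exact hC g hg
  · cases im
    · simp at hg
    · simp at hg; subst hg; exact sOn_isOracleFree q
  · trivial

/-! ### Implementation and statistics of the circuit -/

/-- A matrix not changing wire `q` commutes with the projection onto `{q = 1}`. [folklore] -/
theorem comm_projOn_q {q : Fin N} {U : Matrix (QReg N) (QReg N) ℂ} (hUq : ∀ x z : QReg N, x q ≠ z q → U x z = 0) :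
    U * projOn {z : QReg N | z q = true} = projOn {z : QReg N | z q = true} * U := by
  classical
  ext x z
  rw [projOn, Matrix.mul_diagonal, Matrix.diagonal_mul]
  by_cases hxz : x q = z q
  · simp [Set.indicator_apply, hxz]
  · rw [hUq x z hxz]; simp

/-- The Hadamard gate on `q` preserves a set of labels not constraining `q`. [folklore] -/
theorem preservesSupp_hOn {P : Set (QReg N)} {q : Fin N} (hP : ∀ x b, Function.update x q b ∈ P ↔ x ∈ P) :
    PreservesSupp P ((hOn q).toMatrix 0) := by
  rw [hOn_toMatrix]
  refine preservesSupp_placeGate_of_offWires _ (fun x y hxy => ?_) _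
  have : y = Function.update x q (y q) := by
    funext i; by_cases hi : i = q
    · subst hi; simp
    · rw [Function.update_of_ne hi]; exact (hxy i (by simp [hi])).symm
  rw [this, hP]

/-- **The Hadamard-test circuit implements the Hadamard-test operator** with the error of `C`.
[cite: AharonovJonesLandau2009, §2.2 and Claim 4.1] -/
theorem hadTestCircuit_implOn {P : Set (QReg N)} {q : Fin N} (hP : ∀ x b, Function.update x q b ∈ P ↔ x ∈ P)
    {U : Matrix (QReg N) (QReg N) ℂ} (hU : U ∈ Matrix.unitaryGroup (QReg N) ℂ) (hUq : ∀ x z : QReg N, x q ≠ z q → U x z = 0)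
    (hPU : PreservesSupp P U) {C : QCircuit cliffordT N} {δ : ℝ} (hδ : 0 ≤ δ) (hC : ImplOn P (C.toMatrix 0) (condOn {z : QReg N | z q = true} U) δ)
    (im : Bool) : ImplOn P ((hadTestCircuit q C im).toMatrix 0) (hadTestOp q U (phaseOf im)) δ := by
  have hHu := QGate.toMatrix_mem_unitaryGroup_holds cliffordT_isUnitary_holds (0 : Language Bool) (hOn q)
  have hHgood : (⟨(hOn q).toMatrix 0, (hOn q).toMatrix 0, 0⟩ : ApproxStep N).Good P :=
    ⟨ImplOn.refl P _, isContraction_of_mem_unitaryGroup hHu, isContraction_of_mem_unitaryGroup hHu, preservesSupp_hOn hP, le_rfl⟩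
  have hDu : ctrlPhase q (phaseOf im) ∈ Matrix.unitaryGroup (QReg N) ℂ :=
    diagonal_mem_unitaryGroup_of_norm_eq_one fun x => by split_ifs; exacts [norm_phaseOf im, norm_one]
  have hDgood : (⟨ctrlPhase q (phaseOf im), ctrlPhase q (phaseOf im), 0⟩ : ApproxStep N).Good P :=
    ⟨ImplOn.refl P _, isContraction_of_mem_unitaryGroup hDu, isContraction_of_mem_unitaryGroup hDu, preservesSupp_diagonal P _, le_rfl⟩
  have hCgood : (⟨C.toMatrix 0, condOn {z : QReg N | z q = true} U, δ⟩ : ApproxStep N).Good P :=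
    ⟨hC, isContraction_of_mem_unitaryGroup (QCircuit.toMatrix_mem_unitaryGroup_holds cliffordT_isUnitary_holds 0 C),
      isContraction_condOn _ hU (comm_projOn_q hUq), preservesSupp_condOn _ hPU, hδ⟩
  have h := ImplOn.listProd (P := P) (L := [⟨(hOn q).toMatrix 0, (hOn q).toMatrix 0, 0⟩, ⟨ctrlPhase q (phaseOf im), ctrlPhase q (phaseOf im), 0⟩,
    ⟨C.toMatrix 0, condOn {z : QReg N | z q = true} U, δ⟩, ⟨(hOn q).toMatrix 0, (hOn q).toMatrix 0, 0⟩])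
    (by intro s hs; simp only [List.mem_cons, List.not_mem_nil, or_false] at hs; rcases hs with rfl | rfl | rfl | rfl; exacts [hHgood, hDgood, hCgood, hHgood])
  simp only [List.map_cons, List.map_nil, List.prod_cons, List.prod_nil, Matrix.mul_one, List.sum_cons, List.sum_nil, add_zero, zero_add] at h
  rw [hadTestCircuit_toMatrix, hadTestOp]
  simpa only [Matrix.mul_assoc] using h

/-- The Hadamard-test operator is unitary. [folklore] -/
theorem hadTestOp_mem_unitaryGroup (q : Fin N) {U : Matrix (QReg N) (QReg N) ℂ} (hU : U ∈ Matrix.unitaryGroup (QReg N) ℂ)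
    (hUq : ∀ x z : QReg N, x q ≠ z q → U x z = 0) {s : ℂ} (hs : ‖s‖ = 1) : hadTestOp q U s ∈ Matrix.unitaryGroup (QReg N) ℂ := by
  have hHu := QGate.toMatrix_mem_unitaryGroup_holds cliffordT_isUnitary_holds (0 : Language Bool) (hOn q)
  have hDu : ctrlPhase q s ∈ Matrix.unitaryGroup (QReg N) ℂ :=
    diagonal_mem_unitaryGroup_of_norm_eq_one fun x => by split_ifs; exacts [hs, norm_one]
  exact Submonoid.mul_mem _ (Submonoid.mul_mem _ hHu (Submonoid.mul_mem _ hDu (condOn_mem_unitaryGroup _ hU (comm_projOn_q hUq)))) hHu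

/-- **The statistics of the Hadamard-test circuit**: on a basis input in `P` with `q = 0`, the
probability of reading `0` on `q` is within `δ` of `(1 + Re(s·U_{x₁x₁}))/2`.
[cite: AharonovJonesLandau2009, §2.2 and Thm. 4.3] -/
theorem hadTestCircuit_prob {P : Set (QReg N)} {q : Fin N} (hP : ∀ x b, Function.update x q b ∈ P ↔ x ∈ P)
    {U : Matrix (QReg N) (QReg N) ℂ} (hU : U ∈ Matrix.unitaryGroup (QReg N) ℂ) (hUq : ∀ x z : QReg N, x q ≠ z q → U x z = 0)
    (hPU : PreservesSupp P U) {C : QCircuit cliffordT N} {δ : ℝ} (hδ : 0 ≤ δ) (hC : ImplOn P (C.toMatrix 0) (condOn {z : QReg N | z q = true} U) δ)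
    (im : Bool) {x₀ : QReg N} (hx₀ : x₀ ∈ P) (hx : x₀ q = false) :
    |(∑ y ∈ Finset.univ.filter (fun y : QReg N => y q = false), ‖((hadTestCircuit q C im).toMatrix 0 *ᵥ basisState x₀) y‖ ^ 2) -
      (1 + (phaseOf im * U (Function.update x₀ q true) (Function.update x₀ q true)).re) / 2| ≤ δ := by
  rw [← hadTestOp_prob q hU hUq hx (norm_phaseOf im)]
  exact abs_sum_normSq_sub_le_of_implOn (QCircuit.toMatrix_mem_unitaryGroup_holds cliffordT_isUnitary_holds 0 _)
    (hadTestOp_mem_unitaryGroup q hU hUq (norm_phaseOf im)) (hadTestCircuit_implOn hP hU hUq hPU hδ hC im)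
    (fun y hy => by rw [basisState, Pi.single_apply, if_neg]; rintro rfl; exact hy hx₀) (normSq_basisState x₀) _

end Literature.Computability.QuantumComplexity

end
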